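import Summits.QuantumFields.BalabanUV.Beta.FP.StepLawKHolds
import Summits.QuantumFields.BalabanUV.Beta.TameKernelCalculus
import Literature.MathematicalPhysics.QuantumFieldTheory.Balaban1983to89.B14DeltaBeta

/-!
# `BalabanUV.Beta.FP.WSlotSplit` — road «FP» for binder row D1, ROW (W-SPLIT) of RULING R-FP-38 (owner, gen 10; an2-g27's answer to Q3 of
# `KER-GAMMA-ALPHA2.md` §4: the literal's second-order slot is `W2SymOfK` = sym of `vertex2OfK S₂ + mixOfK + mixOfK′ + dM (K2OfK …)`, so the
# (ASYMP) socket of record — stated for the bi-vertex slot `vertex2OfK K_m N (Wf m)` — meets the literal only after the W-slot is SPLIT):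
# THE ONE-LOOP KERNEL IS ADDITIVE IN ITS W-SLOT AND (ASYMP) TRANSFERS ACROSS A BOUNDED EXTRA PIECE

HONEST DEPENDENCY (page 1, mandatory): continuum YM on T⁴ ⇐ BetaPertH ∧ nine spine estimates (0/9 proved); BetaPertH ⇐ (D1) ∧ (D4) ∧ CAP+tail;
G-an2-4 gates asym, D1 and NE2/3/4.  HONEST FRAMING (cell contract, verbatim): «discharging `BetaPertH` makes Bałaban's UV stability UNCONDITIONAL —
a real constructive-QFT result; it is NOT the continuum limit and NOT the Clay problem.»  THIS MODULE DISCHARGES NOTHING of the wall: it is [folklore]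
bookkeeping — `hessKer`∕`TPerfOf` is LINEAR in the second-order slot (`TameKernelCalculus.tadpole_add` under `Spr`∕`Loc`), (1.22) is linear in the kernel
(`B14DeltaBeta.secondMoment_add` under `MomentSummable`), and a bounded extra second moment moves the (ASYMP) defect by at most its bound.  The extra
pieces' BOUNDS ((G8) «RESP × ONE-POINT», (G-mix-W) «MIXED ONE-POINT» of R-FP-38) and the decomposition of the literal's∕`WPerfOf`'s slot are DISPLAYED
HYPOTHESES.  No `def`, no `def … : Prop`, nothing cited, 0 sorry; 0∕4 row-D1 binders; NOT (G8), NOT (ASYMP) for the literal, NOT D1, NOT BetaPertH,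
NOT continuum, NOT Clay.  «not in print; our bookkeeping».

ABSOLUTE RULE (cell charter, verbatim): «No internally-minted statement may enter as a cited fact. Every hypothesis is either kernel-proved in this package or a
verbatim quotation of a PUBLISHED theorem with page reference. The manuscript(s) under audit are NOT citable for their own disputed steps — they are the thing
under adjudication; programme-internal (2001/route/tribunal) claims are never citable.»

WHAT.  §1 [folklore] **`hessKer_add_W`**: `Spr A`, the two bi-tables' `(μ,0;ν,z)` members `Loc` ⟹ `hessKer A V (W₀ + W₁) μ ν z = hessKer A V W₀ μ ν z + ½·tadpole A (W₁ μ 0 ν z)`;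
**`TPerfOf_add_W`** (the same for `TPerfOf n K S`, `Spr (axDressK n K)` from `Decays K`).  §2 [folklore] **`hasym_of_add_bounded`**: `|m2(T₀ m) − m·s| ≤ Cg`,
`|m2(T₁ m)| ≤ B`, `T m μ ν = T₀ m μ ν + T₁ m μ ν` pointwise, both `MomentSummable` ⟹ `|m2(T m) − m·s| ≤ Cg + B`.  §3 [our object] **`hasym_TPerfOf_of_wslot_split`**:
at the road's objects (`K_m := KPerf Lc (sfStep Lc) (smStep 3 Lc) m`, `N := Lc^m`, ANY first-order family `S m`): if the second-order slot splits as `Wt m = W₀ m + Wx m`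
(DISPLAYED), (ASYMP) holds for the `W₀`-kernel and the extra coarse piece `z ↦ ½·tadpole (axDressK N K_m) (Wx m μ 0 ν z)` has second moment bounded by `B` (DISPLAYED,
rows (G8)∕(G-mix-W)), then (ASYMP) holds for the full slot with defect `Cg + B`.
Provenance: road FP OWNER b2b-balaban-beta-d1-p3 gen 10 (prover-b2b-balaban-beta-d1-p3-g10-0), 2026-08-21, row (W-SPLIT).
-/

noncomputable section

namespace Summit.QuantumFields.BalabanUV.Beta.FP.WSlotSplit

open Literature.MathematicalPhysics.QuantumFieldTheory.Balaban1983to89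
open Literature.MathematicalPhysics.QuantumFieldTheory.Balaban1983to89.Beta
open Literature.MathematicalPhysics.QuantumFieldTheory.Balaban1983to89.B12Normalization (stepBal)
open ExpKernelCalculus (Site MKer Decays BiLoc tadpole bubble hessKer)
open OneStepResolventKernel (Fib)
open AxialDressing (axDressK axVertexOfK decays_axDressK)
open DyadicShell (Pt)
open Summit.QuantumFields.BalabanUV.Beta.TameKernelCalculus (Spr Loc tadpole_add)
open Summit.QuantumFields.BalabanUV.Beta.GAN24.CombesThomas (sfStep smStep)
open Summit.QuantumFields.BalabanUV.Beta.FP.PerfectObjectsT (KPerf TPerfOf)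
open Summit.QuantumFields.BalabanUV.Beta.FP.StepLawKHolds (exists_decays_KPerf_holds)

/-! ## §1 The one-loop kernel is additive in its second-order slot -/

section AddW

variable {D : ℕ} {F : Type*} [Fintype F]

/-- [folklore] **`hessKer` IS ADDITIVE IN THE W-SLOT**: for a spread leg `A` and bi-tables whose `(μ,0;ν,z)` members are localised,
`hessKer A V (W₀ + W₁) μ ν z = hessKer A V W₀ μ ν z + ½·tadpole A (W₁ μ 0 ν z)` (the bubble does not see `W`). -/
theorem hessKer_add_W {A : MKer D F} (hA : Spr A) (V : Fin D → Site D → MKer D F) {W₀ W₁ : Fin D → Site D → Fin D → Site D → MKer D F}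
    (μ ν : Fin D) (z : Site D) (h₀ : Loc (W₀ μ 0 ν z)) (h₁ : Loc (W₁ μ 0 ν z)) :
    hessKer A V (W₀ + W₁) μ ν z = hessKer A V W₀ μ ν z + (1 / 2 : ℝ) * tadpole A (W₁ μ 0 ν z) := by
  simp only [ExpKernelCalculus.hessKer, Pi.add_apply]
  rw [tadpole_add hA h₀ h₁]
  ring

/-- [folklore] **`TPerfOf` IS ADDITIVE IN THE W-SLOT** (`D = 4`): for a decaying packed resolvent `K` (rate `> 0`), blocking `n ≥ 1`, ANY first-order family `S`,
`TPerfOf n K S (W₀ + W₁) μ ν z = TPerfOf n K S W₀ μ ν z + ½·tadpole (axDressK n K) (W₁ μ 0 ν z)`. -/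
theorem TPerfOf_add_W {n : ℕ} (hn : 1 ≤ n) {K : MKer (3 + 1) (Fib 3)} {C δ : ℝ} (hK : Decays K C δ) (hδ : 0 < δ)
    (S : Fin (3 + 1) → (Fin (3 + 1) → ℤ) → MKer (3 + 1) (Fib 3))
    {W₀ W₁ : Fin (3 + 1) → (Fin (3 + 1) → ℤ) → Fin (3 + 1) → (Fin (3 + 1) → ℤ) → MKer (3 + 1) (Fib 3)}
    (μ ν : Fin (3 + 1)) (z : Fin (3 + 1) → ℤ) (h₀ : Loc (W₀ μ 0 ν z)) (h₁ : Loc (W₁ μ 0 ν z)) :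
    TPerfOf n K S (W₀ + W₁) μ ν z = TPerfOf n K S W₀ μ ν z + (1 / 2 : ℝ) * tadpole (axDressK n K) (W₁ μ 0 ν z) := by
  have hA : Spr (axDressK n K) := ⟨_, δ, hδ, decays_axDressK hn hK hδ.le⟩
  exact hessKer_add_W hA _ μ ν z h₀ h₁

end AddW

/-! ## §2 (ASYMP) transfers across a bounded extra piece -/

section Transfer

/-- [folklore] **(ASYMP) TRANSFERS ACROSS A BOUNDED EXTRA PIECE**: if `|m2(T₀ m) − m·s| ≤ Cg`, `|m2(T₁ m)| ≤ B`, `T m μ ν = T₀ m μ ν + T₁ m μ ν` pointwise and both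
pieces are `MomentSummable` in the channel `(μ, ν)`, then `|m2(T m) − m·s| ≤ Cg + B` for every `m ≥ 1` (`m2 := B12Beta.secondMoment · μ ν`). -/
theorem hasym_of_add_bounded {T T₀ T₁ : ℕ → B12Beta.Kernel 4} {μ ν : Fin 4} {s Cg B : ℝ}
    (hT : ∀ m : ℕ, 1 ≤ m → ∀ z, T m μ ν z = T₀ m μ ν z + T₁ m μ ν z)
    (hs₀ : ∀ m : ℕ, 1 ≤ m → B14DeltaBeta.MomentSummable (T₀ m) μ ν) (hs₁ : ∀ m : ℕ, 1 ≤ m → B14DeltaBeta.MomentSummable (T₁ m) μ ν)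
    (h₀ : ∀ m : ℕ, 1 ≤ m → |B12Beta.secondMoment (T₀ m) μ ν - (m : ℝ) * s| ≤ Cg)
    (h₁ : ∀ m : ℕ, 1 ≤ m → |B12Beta.secondMoment (T₁ m) μ ν| ≤ B) :
    ∀ m : ℕ, 1 ≤ m → |B12Beta.secondMoment (T m) μ ν - (m : ℝ) * s| ≤ Cg + B := by
  intro m hm
  have e : B12Beta.secondMoment (T m) μ ν = B12Beta.secondMoment (T₀ m) μ ν + B12Beta.secondMoment (T₁ m) μ ν := by
    rw [← B14DeltaBeta.secondMoment_add (T₀ m) (T₁ m) μ ν (hs₀ m hm) (hs₁ m hm)]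
    unfold B12Beta.secondMoment
    exact tsum_congr fun z => by rw [hT m hm z]; rfl
  rw [e]
  calc |B12Beta.secondMoment (T₀ m) μ ν + B12Beta.secondMoment (T₁ m) μ ν - (m : ℝ) * s|
      = |(B12Beta.secondMoment (T₀ m) μ ν - (m : ℝ) * s) + B12Beta.secondMoment (T₁ m) μ ν| := by ring_nf
    _ ≤ |B12Beta.secondMoment (T₀ m) μ ν - (m : ℝ) * s| + |B12Beta.secondMoment (T₁ m) μ ν| := abs_add_le _ _
    _ ≤ Cg + B := add_le_add (h₀ m hm) (h₁ m hm)

end Transfer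

/-! ## §3 At the road's objects: (ASYMP) for the full W-slot from the bi-vertex part and the extra coarse piece -/

section Road

variable {Lc : ℕ} [NeZero Lc]

/-- [our object] **(ASYMP) FOR THE FULL SECOND-ORDER SLOT ⟸ (ASYMP) FOR THE `W₀`-KERNEL ∧ A BOUNDED EXTRA COARSE PIECE** (row (W-SPLIT) of R-FP-38).
Objects: `K_m := KPerf Lc (sfStep Lc) (smStep 3 Lc) m`, `N := Lc^m`, ANY first-order family `S m`, a second-order slot split `Wt m = W₀ m + Wx m` (the road:
`W₀ m := vertex2OfK K_m N (Wf m)` = the bi-vertex part served by the junction END; `Wx m` = the literal's response + mixed summands, an2's Q3).  DISPLAYED: the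
`Loc` letters of the two slots' `(μ,0;ν,z)` members, the `MomentSummable` letters of the two coarse pieces, (ASYMP) for the `W₀`-kernel with defect `Cg`, and the
bound `B` of the extra piece's second moment (rows (G8)∕(G-mix-W)).  CONCLUSION: (ASYMP) for `TPerfOf N K_m (S m) (Wt m)` with defect `Cg + B`. -/
theorem hasym_TPerfOf_of_wslot_split (hLc : 2 ≤ Lc)
    {S : ℕ → Fin (3 + 1) → (Fin (3 + 1) → ℤ) → MKer (3 + 1) (Fib 3)}
    {Wt W₀ Wx : ℕ → Fin (3 + 1) → (Fin (3 + 1) → ℤ) → Fin (3 + 1) → (Fin (3 + 1) → ℤ) → MKer (3 + 1) (Fib 3)}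
    (hsplit : ∀ m : ℕ, 1 ≤ m → Wt m = W₀ m + Wx m)
    {μ ν : Fin (3 + 1)}
    (hloc₀ : ∀ m : ℕ, 1 ≤ m → ∀ z, Loc (W₀ m μ 0 ν z)) (hlocx : ∀ m : ℕ, 1 ≤ m → ∀ z, Loc (Wx m μ 0 ν z))
    (hs₀ : ∀ m : ℕ, 1 ≤ m → B14DeltaBeta.MomentSummable
      (TPerfOf (Lc ^ m) (KPerf (d := 3) Lc (sfStep Lc) (smStep 3 Lc) m) (S m) (W₀ m)) μ ν)
    (hsx : ∀ m : ℕ, 1 ≤ m → B14DeltaBeta.MomentSummable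
      (fun μ' ν' z => (1 / 2 : ℝ) * tadpole (axDressK (Lc ^ m) (KPerf (d := 3) Lc (sfStep Lc) (smStep 3 Lc) m)) (Wx m μ' 0 ν' z)) μ ν)
    {s Cg B : ℝ}
    (hasym₀ : ∀ m : ℕ, 1 ≤ m →
      |B12Beta.secondMoment (TPerfOf (Lc ^ m) (KPerf (d := 3) Lc (sfStep Lc) (smStep 3 Lc) m) (S m) (W₀ m)) μ ν - (m : ℝ) * s| ≤ Cg)
    (hextra : ∀ m : ℕ, 1 ≤ m →
      |B12Beta.secondMoment
          (fun μ' ν' z => (1 / 2 : ℝ) * tadpole (axDressK (Lc ^ m) (KPerf (d := 3) Lc (sfStep Lc) (smStep 3 Lc) m)) (Wx m μ' 0 ν' z)) μ ν| ≤ B) :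
    ∀ m : ℕ, 1 ≤ m →
      |B12Beta.secondMoment (TPerfOf (Lc ^ m) (KPerf (d := 3) Lc (sfStep Lc) (smStep 3 Lc) m) (S m) (Wt m)) μ ν - (m : ℝ) * s| ≤ Cg + B := by
  refine hasym_of_add_bounded (T₀ := fun m => TPerfOf (Lc ^ m) (KPerf (d := 3) Lc (sfStep Lc) (smStep 3 Lc) m) (S m) (W₀ m))
    (T₁ := fun m μ' ν' z => (1 / 2 : ℝ) * tadpole (axDressK (Lc ^ m) (KPerf (d := 3) Lc (sfStep Lc) (smStep 3 Lc) m)) (Wx m μ' 0 ν' z))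
    (fun m hm z => ?_) hs₀ hsx hasym₀ hextra
  have hn1 : 1 ≤ Lc ^ m := Nat.one_le_pow _ _ (by omega)
  obtain ⟨CK, δK, hδK, hK⟩ := exists_decays_KPerf_holds hLc hm
  rw [hsplit m hm]
  exact TPerfOf_add_W hn1 hK hδK (S m) μ ν z (hloc₀ m hm z) (hlocx m hm z)

end Road

end Summit.QuantumFields.BalabanUV.Beta.FP.WSlotSplit

end
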